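import Summits.QuantumFields.YangMills.Theorems.BalabanUVNodesN07RadialHolCoverLift
import Literature.MathematicalPhysics.QuantumFieldTheory.Balaban1983to89.Node00.TorusCoverGaugeAveragesZd
import Literature.MathematicalPhysics.QuantumFieldTheory.Balaban1983to89.B8Eq115GaugeFixingRec
import Literature.MathematicalPhysics.QuantumFieldTheory.Balaban1983to89.B8Eq119TwistedAxialRec
import Literature.MathematicalPhysics.QuantumFieldTheory.Balaban1983to89.B16Sect1Backgrounds
import Literature.MathematicalPhysics.QuantumFieldTheory.Balaban1983to89.B12GaugeOrbits021
import Literature.MathematicalPhysics.QuantumFieldTheory.Balaban1983to89.B15Eq177GaugeInvariance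
import Literature.MathematicalPhysics.QuantumFieldTheory.Balaban1983to89.T4AxialGaugeRooted
import HarnessLib

/-!
# N07 [B11] (= [15] = [Balaban1985Variational]) Sect. F — **THE RECORD's `ℤᵈ` TOWER GAUGE OF THE LIFT IS THE TORUS RADIAL-TOWER GAUGE × THE ROOTED TOP AXIAL FUNCTION, READ
# THROUGH THE COVER** (g10's knit item (3c): the identification of the R7 door's `v = localGaugeZ …` with the chart's `h̄·w`; currency-free, needed on every road for row 9)

Cell `pub-ymgap`, width seat `pub-ymgap-dag-n07-w3` g11 (N05-REC R7 → THE KNIT).  `--kind proof --supports stmt-QuantumFields-20542 --as helper` (K1⁷; count-neutral).  THEOREMS ONLY.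
[6] = [Balaban1985RegularSpaces]; [3] = [Balaban1985Averaging]; [15] = [Balaban1985Variational]; [B5] = [Balaban1984PropagatorsI]; [I] = [Balaban1987RG1].

WHY.  The R7 door's member row (v) reads the torus gauge `u` of S3 on `□₀ᶻ` as `ιSU (u (π(x + c_k·𝟙))) = (um x)⁻¹ · v(x)` with `v = localGaugeZ L tLo tHi V k ctr`, the RECORD's
explicit tower gauge (dag-n05-d `B8Eq115GaugeFixingRec.tgZ ∕ towerGaugeZ`: (1.15) down the CENTRED blocks + the global axial gauge of `Ūᵏ` at the top centre) of the top-anchored lift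
`V x μ = ιSU (U ⟨π(x + c_k·𝟙), μ⟩)`; every normalisation text of the K0 road (dag-n07-e `NrmDbarWideOfRecord`, the sheared (88)∕(154)₁ of dag-n07-w6, …) reads `u` against `h̄·w` — `w`
a RESIDUAL gauge with `U^w` RADIAL-axial below `k` ([6] (1.15) on [B5] (1.7)'s contours, `…N07RadialAxialTower.exists_residual_radialTower_record`) and `h̄ = blockLift k h` the block lift
of the ROOTED top axial gauge `h = axialGaugeAt (M^k(U^w)) lo hi ctr`.  THIS FILE identifies the two, exactly, for the GUARDED record averages (`avgIterZG`, which ARE the torus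
averages of record through the cover — this lineage's g9 FILE 39 `avgIterZG_coverLift_eq_iter`): BY INDUCTION DOWN THE TOWER, the depth-`n` value of `tgZ` at a level-`(k−n)` label
`x` is `ι(h₀(fl^[n] x)) · ι(w(embIter (k−n) (π_{k−n}(x + c_n·𝟙))))` — `h₀ = axialFn (pull (M^k U)) ctr` the axial function of the pulled-back top averages from `ctr` at the level-`k`
label `fl^[n] x` of `x` (`fl` = the centred block map), the second factor the residual tower gauge READ at the level-`(k−n)` cover of `x`.  The step is [6] (1.15) for
`M^{k−n−1}(U^w)` on ONE centred block, through g9 FILE 41 `axialFn_avgIterZG_coverLift_eq_radialHol` (the recursion's factor `Ū^{k−n−1}(Γ_{L•z, x})` IS `M^{k−n−1}U(Γ_{y′,x′})` of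
record) and the covariance `M^i(U^w)(Γ_{y′,x′}) = w(ȳ′)·M^iU(Γ_{y′,x′})·w(x̄′)⁻¹` (r13 `iter_gaugeAct` + pub-balaban3d `radialHol_gaugeAct`); the base is g9 FILE 39's top row and
(0.21) `w = 1` on `T^{(k)}`.  At depth `k` this is the FINE gauge `towerGaugeZ`'s value at every `x ∈ ℤᵈ`.  On a non-wrapping label window `[lo, hi] ∋ flmZ L k x` the top factor IS
pv26∕T4's rooted torus gauge `h = axialGaugeAt (M^k(U^w)) lo hi ctr` read at `π_k(flmZ L k x) = B^k(π(x + c_k·𝟙))`, so the product is `(h̄·w)(π(x + c_k·𝟙))`.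
NO smallness, NO clamping, NO window is needed for the identity itself (guarded averages throughout); the door's `localGaugeZ` is `towerGaugeZ` of the CLAMPED lift with UNGUARDED
averages — equal to the present object on the window under the run's small-field class (dag-n05-d `B8Ineq133Rec.avgIterZ_eq_of_agree`, `BlockAveragingZd.bavgZG_eq_bavgZ_of_small`):
that bookkeeping is NOT done here (successor file).

WHAT IS PROVED (kernel; `P : Params`, `N ≥ 1`; `AV := fun _ => blockAvg expMeanLogSU` = `avOfRecord` letter for letter; axioms standard).
§1 `axialFn_map` · `blockIter_cover` (`B^n(π x) = π_n ⌊x∕Lⁿ⌋`) · `blockIter_cover_add_ctrShift` (`B^n(π(x + c_n·𝟙)) =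
   π_n(flmZ L n x)`) · ★ `radialHol_iter_eq_of_residual_radialTower` ((1.15) for `U^w` as an identity for `U`: `M^iU(Γ_{y′,x′}) = w(embIter (i+1) y′)⁻¹ · w(embIter i x′)` on `B(y′)`).
§2 ★★★ `tgZ_avgIterZG_coverLift_eq` (the induction, all depths `n ≤ k`, all `x`); ★★★ `towerGaugeZ_avgIterZG_coverLift_eq` (depth `k`: the fine gauge, with `flmZ`).
§3 ★★ `towerGaugeZ_avgIterZG_coverLift_eq_blockLift_axialGaugeAt_mul` — on a non-wrapping label window `[lo, hi] ∋ flmZ L k x`: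
   `tgZ L (avgIterZG L δ V) k ctr k x = ιSU (blockLift k (axialGaugeAt (M^k(U^w)) lo hi ctr) (π(x + c_k·𝟙)) · w (π(x + c_k·𝟙)))` (`M^k(U^w) = M^k U` for residual `w`).
HONEST FRAMING: count-neutral kernel gauge algebra BY NAME (dag-n05-d, this lineage's g9, dag-n07-w6's road objects, r13, r15, dag-p07, pub-balaban3d, pv26∕T4); nothing of [6]∕[3]∕[15]∕[I]
analysis asserted; the clamped∕unguarded bookkeeping and the use in row 9 are NOT done here; `HThm4RecDbar` ∕ `HThm4Rec` UNDISCHARGED (caveat (C-S3-1)); N05 ∕ N07 NOT discharged;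
counts unmoved (typed 28∕28 · discharged 8∕27); one finite 𝕋⁴ programme at fixed ε — R4 closes the conditional finite-𝕋⁴ rung `BalabanLadder.UV` only; the YM mass gap (Clay) is NOT
proved by any of this; nothing continuum ∕ ℝ⁴ ∕ OS.  No `def`, no `instance`, no `notation`, no `sorry`.

References: [6] (1.14)–(1.15) p. 78, p. 98; [3] (7)–(11) pp. 18–19, p. 24, (43) p. 24, (81)∕(87) pp. 30–31; [B5] (1.7) p. 18; [15] (147) p. 301, (181) p. 307; [I] (0.1) p. 251,
(0.3)–(0.4) pp. 252–253, (0.6) p. 253, (0.21) p. 256.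
-/

set_option autoImplicit false

noncomputable section

open scoped Matrix.Norms.L2Operator

namespace Summit.QuantumFields.YangMills.BalabanUVNodes.N07TowerGaugeCoverLift

open Literature.MathematicalPhysics.QuantumFieldTheory.Balaban1983to89
open Literature.MathematicalPhysics.QuantumFieldTheory.Balaban1983to89.Node00
open Literature.MathematicalPhysics.QuantumLattice (blockMap)
open Summit.QuantumFields.Balaban3D.Carriers
open Summit.QuantumFields.YangMills.BalabanUVNodes.N07RadialHolCoverLift
open B15Eq112TorusCover (cover)
open B14DomainGeom (Pt)
open B7Prop1Explicit (hol treeWord axialFn)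
open BlockAveragingZd (offZ ctrShift avgIterZG)
open BlockAveraging (blockAvg)
open ExpMeanLog (expMeanLogSU deltaSU)
open B8Ineq130Rec (fl)
open B8Eq115GaugeFixingRec (tgZ tgZ_zero tgZ_succ exists_block fl_block)
open B8Eq119TwistedAxialRec (flmZ iterate_fl_eq_flmZ)
open B16Sect1Backgrounds (toMS iter_gaugeAct)
open B12GaugeOrbits021 (IsResidual)
open B15Eq177GaugeInvariance (blockLift blockIter_embIter)
open B14.Eq22Determines (blockIter_succ)
open B15DeterminingSets (embIter)
open T4AxialGaugeRooted (axialGaugeAt axialGaugeAt_castSite)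
open T4AxialGaugeSmallField (pull castSite)

variable {P : Params}

/-! ## §1  Bookkeeping -/

section Generic

variable {d : ℕ} {G H : Type*} [Group G] [Group H]

/-- A group homomorphism passes through the axial function: `axialFn (f ∘ V) y x = f (axialFn V y x)` (`hol_map`). [cite: Balaban1985Averaging, (7)–(9) p.18 (bookkeeping)] -/
theorem axialFn_map (f : G →* H) (V : B7Prop1Explicit.Site d → Fin d → G) (y x : B7Prop1Explicit.Site d) :
    axialFn (fun x' μ => f (V x' μ)) y x = f (axialFn V y x) := by
  unfold axialFn
  exact hol_map f V y _

end Generic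

section Blocks

/-- `B^n(π x) = π_n ⌊x∕Lⁿ⌋` (standing range `n ≤ m + K`): r15's `blockIter` read on the covers — the twin of NODE 00's `iterBlockOf_cover` for `B14.Eq22Determines.blockIter`
(`blockOf_coverAt` + `blockMap_blockMap`). [cite: Balaban1984PropagatorsI, (1.18) p.20; Balaban1987RG1, (0.1) p.251] -/
theorem blockIter_cover : ∀ {n : ℕ}, n ≤ P.m + P.K → ∀ x : Pt P.d, B14.Eq22Determines.blockIter n (cover P x) = coverAt P n (blockMap (P.L ^ n) x)
  | 0, _, x => by
    rw [pow_zero]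
    show cover P x = coverAt P 0 _
    rw [coverAt_zero]
    congr 1
    funext μ
    simp [blockMap]
  | n + 1, hn, x => by
    rw [blockIter_succ, blockIter_cover (Nat.le_of_succ_le hn) x, blockOf_coverAt hn, blockMap_blockMap, pow_succ]

/-- `B^n(π(x + c_n·𝟙)) = π_n(flmZ L n x)`: the level-`n` block of the TOP-ANCHORED fine site is the level-`n` cover of the CENTRED `Lⁿ`-block label of `x` (`n ≤ m + K`).
[cite: Balaban1987RG1, (0.1) p.251, (0.3) p.252 (bookkeeping)] -/
theorem blockIter_cover_add_ctrShift {n : ℕ} (hn : n ≤ P.m + P.K) (x : Pt P.d) :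
    B14.Eq22Determines.blockIter n (cover P (x + fun _ => ((ctrShift P.L n : ℕ) : ℤ))) = coverAt P n (flmZ P.L n x) := by
  rw [blockIter_cover hn]
  have h : blockMap (P.L ^ n) (x + fun _ => ((ctrShift P.L n : ℕ) : ℤ)) = flmZ P.L n x := by
    funext i
    simp only [blockMap, flmZ, Pi.add_apply, Nat.cast_pow]
  rw [h]

end Blocks

/-! ## §1b  (1.15) for `U^w`, residual `w`, as an identity for `U` on one centred block -/

section Tower

variable (N : ℕ) [NeZero N]

/-- ★ **[6] (1.15) FOR `U^w` READ AS AN IDENTITY FOR `U`**: if `M^i(U^w)` is in the block axial gauge of the (1.7) contours (`i + 1 ≤ m + K`), then for every level-`(i+1)` site `y′` and every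
`x′ ∈ B(y′)`: `M^iU(Γ_{y′,x′}) = w(embIter (i+1) y′)⁻¹ · w(embIter i x′)` — the covariance `M^i(U^w) = (M^iU)^{w↾T^{(i)}}` (r13 `iter_gaugeAct`, [3] (11)) and
`V^{g}(Γ_{y,x}) = g(ȳ)·V(Γ_{y,x})·g(x)⁻¹` (pub-balaban3d `radialHol_gaugeAct`); at the centre both sides are `1` (g9 `radialHol_emb`). [cite: Balaban1985RegularSpaces, (1.15) p.78; Balaban1985Averaging, (11) p.19; Balaban1984PropagatorsI, (1.7) p.18] -/
theorem radialHol_iter_eq_of_residual_radialTower (U : GaugeField P 0 (SU N)) (w : GaugeTransf P 0 (SU N)) {i : ℕ} (hi : i + 1 ≤ P.m + P.K)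
    (hax : AxialGauge (radialContourData P i (SU N)) (Averaging.iter (fun _ => blockAvg expMeanLogSU) i (GaugeField.gaugeAct w U)))
    {y' : Site P (i + 1)} {x' : Site P i} (hx' : blockOf x' = y') :
    radialHol (Averaging.iter (fun _ => blockAvg expMeanLogSU) i U) y' x' = (w (embIter (i + 1) y'))⁻¹ * w (embIter i x') := by
  by_cases hctr : x' = emb y'
  · subst hctr
    rw [radialHol_emb hi]
    show (1 : SU N) = (w (embIter i (emb y')))⁻¹ * w (embIter i (emb y'))
    rw [inv_mul_cancel]
  · have h := hax y' x' hx' hctr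
    rw [radialContourData_holTo, iter_gaugeAct (fun _ => blockAvg expMeanLogSU) w U i (Nat.le_of_succ_le hi), radialHol_gaugeAct] at h
    -- `h : w(ȳ′) · M^iU(Γ) · w(x̄′)⁻¹ = 1`
    have h' : radialHol (Averaging.iter (fun _ => blockAvg expMeanLogSU) i U) y' x' =
        (toMS w i (emb y'))⁻¹ * toMS w i x' := by
      have := congrArg (fun g => (toMS w i (emb y'))⁻¹ * g * toMS w i x') h
      simpa [mul_assoc] using this
    rw [h']
    rfl

/-! ## §2  ★★★ The identification, by induction down the tower -/

/-- ★★★ **THE RECORD's `ℤᵈ` TOWER GAUGE OF THE TOP-ANCHORED LIFT, AT EVERY DEPTH, IS (ROOTED TOP AXIAL FUNCTION) × (RESIDUAL RADIAL-TOWER GAUGE) THROUGH THE COVER.**  For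
`k ≤ m + K`, a torus field `U`, a RESIDUAL `w` of level `k` ((0.21): `w = 1` on `T^{(k)}`) with `M^i(U^w)` radial-axial for all `i < k` ([6] (1.15) on [B5] (1.7)'s contours), a root
`ctr ∈ ℤᵈ`, and the guarded record averages `Ūʲ = avgIterZG L δ_N V j` of the lift `V x μ = ιSU (U ⟨π(x + c_k·𝟙), μ⟩)`: for every depth `n ≤ k` and EVERY level-`(k−n)` label `x`,
`tgZ L Ū k ctr n x = ιSU (axialFn (pull (M^k U)) ctr (fl^[n] x)) · ιSU (w (embIter (k−n) (π_{k−n}(x + c_n·𝟙))))` — dag-n05-d's recursion `u_j(x) = u_{j+1}(fl x)·Ūʲ(Γ_{L•fl x, x})`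
matched level by level with (1.15) for `U^w` (`radialHol_iter_eq_of_residual_radialTower`), the factor `Ūʲ(Γ_{L•z, L•z + offZ r})` being `M^jU(Γ_{y′, blockSite y′ r})` of record
(g9 `axialFn_avgIterZG_coverLift_eq_radialHol`, `y′ = π_{j+1}(z + c_{k−j−1}·𝟙)`, `blockSite y′ r = π_j(x + c_{k−j}·𝟙)` by g9 `coverAt_smul_add_ctrShift_succ` ∕ `coverAt_add_offZ_eq_blockSite`);
base: g9 `avgIterZG_coverLift_eq_iter_top` and `w = 1` on `T^{(k)}`. [cite: Balaban1985RegularSpaces, (1.14)–(1.15) p.78, p.98; Balaban1985Averaging, (11) p.19, (43) p.24, (87) p.31; Balaban1987RG1, (0.1) p.251, (0.3)–(0.4) pp.252–253, (0.21) p.256] -/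
theorem tgZ_avgIterZG_coverLift_eq {k : ℕ} (hk : k ≤ P.m + P.K) (U : GaugeField P 0 (SU N)) (w : GaugeTransf P 0 (SU N)) (hres : IsResidual k w)
    (hax : ∀ i, i < k → AxialGauge (radialContourData P i (SU N)) (Averaging.iter (fun _ => blockAvg expMeanLogSU) i (GaugeField.gaugeAct w U)))
    (ctr : Pt P.d) :
    ∀ n, n ≤ k → ∀ x : Pt P.d,
      tgZ P.L (avgIterZG P.L (deltaSU (Fin N)) (fun x μ => ιSU N (U ⟨cover P (x + fun _ => ((ctrShift P.L k : ℕ) : ℤ)), μ⟩))) k ctr n x =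
        ιSU N (axialFn (pull (Averaging.iter (fun _ => blockAvg expMeanLogSU) k U)) ctr ((fl P.L)^[n] x)) *
          ιSU N (w (embIter (k - n) (coverAt P (k - n) (x + fun _ => ((ctrShift P.L n : ℕ) : ℤ)))))
  | 0, _, x => by
    have h0 : (x + fun _ => ((ctrShift P.L 0 : ℕ) : ℤ)) = x := by funext μ; simp [BlockAveragingZd.ctrShift]
    rw [tgZ_zero, Function.iterate_zero, id, Nat.sub_zero, h0, hres (coverAt P k x), map_one, mul_one]
    -- the top level: `Ūᵏ = ι ∘ pull (M^k U)` (g9 FILE 39, top row), then `ι` passes through `axialFn`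
    have htop : avgIterZG P.L (deltaSU (Fin N)) (fun x μ => ιSU N (U ⟨cover P (x + fun _ => ((ctrShift P.L k : ℕ) : ℤ)), μ⟩)) k =
        fun z κ => ιSU N (pull (Averaging.iter (fun _ => blockAvg expMeanLogSU) k U) z κ) := by
      funext z κ
      rw [avgIterZG_coverLift_eq_iter_top N hk U z κ]
      rfl
    rw [htop, axialFn_map]
  | n + 1, hn, x => by
    obtain ⟨s, hs⟩ := P.hL.1
    have hL : P.L = 2 * s + 1 := by omega
    have ih := tgZ_avgIterZG_coverLift_eq hk U w hres hax ctr n (Nat.le_of_succ_le hn) (fl P.L x)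
    -- the level of this step: `i := k − (n+1)`, `i + 1 = k − n`
    have hi : k - (n + 1) < k := by omega
    have hi1 : k - (n + 1) + 1 = k - n := by omega
    have hki : k - (k - (n + 1) + 1) = n := by omega
    have hik : k - (n + 1) + 1 ≤ P.m + P.K := by omega
    -- decompose `x = L•z + offZ r`, `z = fl x`
    obtain ⟨r, hx⟩ := exists_block hL x
    set z : Pt P.d := fl P.L x with hz
    rw [tgZ_succ, ih, Function.iterate_succ_apply]
    -- the recursion's factor through the cover
    have hfac := axialFn_avgIterZG_coverLift_eq_radialHol N hk U hi z r
    rw [hki] at hfac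
    have hxz : x = (P.L : ℤ) • z + offZ P.L r := hx
    have hfac' : axialFn (avgIterZG P.L (deltaSU (Fin N)) (fun x μ => ιSU N (U ⟨cover P (x + fun _ => ((ctrShift P.L k : ℕ) : ℤ)), μ⟩)) (k - (n + 1)))
        ((P.L : ℤ) • fl P.L x) x =
        ιSU N (radialHol (Averaging.iter (fun _ => blockAvg expMeanLogSU) (k - (n + 1)) U)
          (coverAt P (k - (n + 1) + 1) (z + fun _ => ((ctrShift P.L n : ℕ) : ℤ)))
          (Site.blockSite (coverAt P (k - (n + 1) + 1) (z + fun _ => ((ctrShift P.L n : ℕ) : ℤ))) r)) := by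
      rw [← hz]; conv_lhs => rw [hxz]
      exact hfac
    rw [hfac']
    -- (1.15) for `U^w` at this block
    set y' : Site P (k - (n + 1) + 1) := coverAt P (k - (n + 1) + 1) (z + fun _ => ((ctrShift P.L n : ℕ) : ℤ)) with hy'
    have hblock : blockOf (Site.blockSite y' r) = y' := Site.blockOf_blockSite hik y' r
    rw [radialHol_iter_eq_of_residual_radialTower N U w hik (hax _ hi) hblock]
    -- the reading points: `embIter (k−n) (π_{k−n}(fl x + c_n))` IS `embIter (i+1) y′`, and `π_i(x + c_{n+1}) = blockSite y′ r`
    have hsite : coverAt P (k - (n + 1)) (x + fun _ => ((ctrShift P.L (n + 1) : ℕ) : ℤ)) = Site.blockSite y' r := by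
      have hq := coverAt_smul_add_ctrShift_succ (P := P) hik n z
      have h1 : (x + fun _ => ((ctrShift P.L (n + 1) : ℕ) : ℤ)) =
          ((P.L : ℤ) • z + fun _ => ((ctrShift P.L (n + 1) : ℕ) : ℤ)) + offZ P.L r := by
        rw [hxz]; abel
      rw [h1, coverAt_add_offZ_eq_blockSite hq r]
    rw [hsite]
    have hread : embIter (k - n) (coverAt P (k - n) (fl P.L x + fun _ => ((ctrShift P.L n : ℕ) : ℤ))) = embIter (k - (n + 1) + 1) y' := by
      rw [hy', ← hz, hi1]
    rw [hread, map_mul, map_inv]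
    -- assemble: `a · ι(w₊) · (ι(w₊)⁻¹ · ι(w_x)) = a · ι(w_x)`
    rw [← mul_assoc, mul_assoc (ιSU N _) (ιSU N (w _)), mul_inv_cancel, mul_one]

/-- ★★★ **THE FINE GAUGE**: at depth `k` the tower gauge transformation `towerGaugeZ L V k ctr = tgZ L Ū k ctr k` (its value at every `x ∈ ℤᵈ`) is the rooted top axial function at the
centred `Lᵏ`-block label `flmZ L k x` times the residual tower gauge at the covered site `π(x + c_k·𝟙)`. [cite: Balaban1985RegularSpaces, (1.14)–(1.15) p.78, p.98; Balaban1987RG1, (0.3)–(0.4) pp.252–253, (0.21) p.256] -/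
theorem towerGaugeZ_avgIterZG_coverLift_eq {k : ℕ} (hk : k ≤ P.m + P.K) (U : GaugeField P 0 (SU N)) (w : GaugeTransf P 0 (SU N)) (hres : IsResidual k w)
    (hax : ∀ i, i < k → AxialGauge (radialContourData P i (SU N)) (Averaging.iter (fun _ => blockAvg expMeanLogSU) i (GaugeField.gaugeAct w U)))
    (ctr x : Pt P.d) :
    tgZ P.L (avgIterZG P.L (deltaSU (Fin N)) (fun x μ => ιSU N (U ⟨cover P (x + fun _ => ((ctrShift P.L k : ℕ) : ℤ)), μ⟩))) k ctr k x =
      ιSU N (axialFn (pull (Averaging.iter (fun _ => blockAvg expMeanLogSU) k U)) ctr (flmZ P.L k x)) *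
        ιSU N (w (cover P (x + fun _ => ((ctrShift P.L k : ℕ) : ℤ)))) := by
  rw [tgZ_avgIterZG_coverLift_eq N hk U w hres hax ctr k le_rfl x, iterate_fl_eq_flmZ P.hL.1, Nat.sub_self]
  rfl

/-! ## §3  On a non-wrapping label window: the rooted torus gauge `axialGaugeAt` and its block lift -/

/-- The residual `w` does not move the top averages: `M^k(U^w) = M^k U` (r13 `iter_gaugeAct`, `w = 1` on `T^{(k)}`). [cite: Balaban1987RG1, (0.21) p.256; Balaban1985Averaging, (11) p.19] -/
theorem iter_gaugeAct_eq_of_residual {k : ℕ} (hk : k ≤ P.m + P.K) (U : GaugeField P 0 (SU N)) (w : GaugeTransf P 0 (SU N)) (hres : IsResidual k w) :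
    Averaging.iter (fun _ => blockAvg expMeanLogSU) k (GaugeField.gaugeAct w U) = Averaging.iter (fun _ => blockAvg expMeanLogSU) k U := by
  rw [iter_gaugeAct (fun _ => blockAvg expMeanLogSU) w U k hk]
  have h1 : toMS w k = fun _ => 1 := funext fun y => hres y
  rw [h1]
  funext b
  simp [GaugeField.gaugeAct]

/-- ★★ **THE IDENTIFICATION IN THE CHART's LETTERS**: on a label window `[lo, hi]` of `T^{(k)}` that does not wrap (`hi − lo < sitesPerDir k` coordinatewise) and contains the centred
`Lᵏ`-block label `flmZ L k x` of the fine point `x`, the record's tower gauge of the lift at `x` IS `(h̄·w)(π(x + c_k·𝟙))` with `h := axialGaugeAt (M^k(U^w)) lo hi ctr` (pv26∕T4's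
rooted torus axial gauge, `= axialFn (pull ·) ctr` on the window) and `h̄ = blockLift k h` ([15] (181)), the block being `B^k(π(x + c_k·𝟙)) = π_k(flmZ L k x)`.
[cite: Balaban1985Variational, (147) p.301, (181) p.307; Balaban1985RegularSpaces, (1.15) p.78, p.98; Balaban1987RG1, (0.1) p.251, (0.3) p.252, (0.21) p.256] -/
theorem towerGaugeZ_avgIterZG_coverLift_eq_blockLift_axialGaugeAt_mul {k : ℕ} (hk : k ≤ P.m + P.K) (U : GaugeField P 0 (SU N)) (w : GaugeTransf P 0 (SU N))
    (hres : IsResidual k w)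
    (hax : ∀ i, i < k → AxialGauge (radialContourData P i (SU N)) (Averaging.iter (fun _ => blockAvg expMeanLogSU) i (GaugeField.gaugeAct w U)))
    (ctr : Pt P.d) {lo hi : Pt P.d} (hN : ∀ κ, hi κ - lo κ < P.sitesPerDir k) {x : Pt P.d} (hlo : lo ≤ flmZ P.L k x) (hhi : flmZ P.L k x ≤ hi) :
    tgZ P.L (avgIterZG P.L (deltaSU (Fin N)) (fun x μ => ιSU N (U ⟨cover P (x + fun _ => ((ctrShift P.L k : ℕ) : ℤ)), μ⟩))) k ctr k x =
      ιSU N (blockLift k (axialGaugeAt (Averaging.iter (fun _ => blockAvg expMeanLogSU) k (GaugeField.gaugeAct w U)) lo hi ctr)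
          (cover P (x + fun _ => ((ctrShift P.L k : ℕ) : ℤ))) * w (cover P (x + fun _ => ((ctrShift P.L k : ℕ) : ℤ)))) := by
  rw [towerGaugeZ_avgIterZG_coverLift_eq N hk U w hres hax ctr x, map_mul, blockLift, blockIter_cover_add_ctrShift hk,
    iter_gaugeAct_eq_of_residual N hk U w hres]
  congr 2
  exact (axialGaugeAt_castSite _ ctr hN hlo hhi).symm

end Tower

end Summit.QuantumFields.YangMills.BalabanUVNodes.N07TowerGaugeCoverLift

end

/-! ## Axiom audit (gate whitelist: `propext`, `Classical.choice`, `Quot.sound`) -/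
#print axioms Summit.QuantumFields.YangMills.BalabanUVNodes.N07TowerGaugeCoverLift.towerGaugeZ_avgIterZG_coverLift_eq_blockLift_axialGaugeAt_mul
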